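import Mathlib.Analysis.Calculus.IteratedDeriv.Defs
import Mathlib.Topology.Bornology.BoundedOperation
import Literature.Probability.LatticeModels.DomainDiscretisation
import Literature.Probability.LatticeModels.LatticeInterface
import Literature.Probability.RandomPlanarGeometry.HalfPlaneFill
import Literature.Probability.RandomPlanarGeometry.HalfPlaneFillProofs
import Literature.Probability.RandomPlanarGeometry.HullThickening
import Literature.Probability.RandomPlanarGeometry.HydrodynamicMaps
import Literature.Probability.RandomPlanarGeometry.HullHausdorffKernel
import Literature.Probability.RandomPlanarGeometry.StarHullExtension
import Literature.Probability.RandomPlanarGeometry.RestrictionHullsRiemannProofs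
import Literature.Probability.RandomPlanarGeometry.SLERestrictionLemmasProofs
import Literature.Probability.RandomPlanarGeometry.HullSubdomainPullback
import HarnessLib

/-!
# Half-plane Loewner coordinates of a growing lattice slit (capacity time, driving value, increments)

Definition file (requested by route `SAWSteinDefect` of `CriticalPhenomena/SAWScalingLimit`, idea
card *stein-restriction-defect-tomography*: "definition requests … `dξ_u`, `dt_u` (half-plane
capacity parametrisation of lattice slits …; a `slitIncrement` API is needed)"). A lattice path
`η` of the discrete domain `Ω_δ` (`Literature.Probability.LatticeModels.discreteDomainGraph`) of a
Dobrushin domain `(D; a, b)`, started at a lattice point `a_δ` and currently at the tip `w`, is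
pulled back to the upper half-plane by a chordal uniformizing map `φ : (ℍ; 0, ∞) → (D; a, b)` and
read in the coordinates of chordal Loewner theory:

* G. F. Lawler, *Conformally Invariant Processes in the Plane*, AMS (2005) [Lawler2005], §3.4
  (Prop. 3.36: `g_A`, the unique conformal `ℍ ∖ A → ℍ` with `g_A(z) - z → 0`; Def. 3.37:
  `hcap(A) = lim z (g_A(z) - z)`; p. 69: `g_{A+x}(z) = g_A(z - x) + x`; (3.8): monotonicity /
  additivity of `hcap`), §4.1 (p. 94: `g_t = g_{γ(0,t]}`, `b(t) = hcap(γ(0, t])`; Lemma 4.2: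
  "there is a unique `U_t ∈ ℝ` with `g_t(γ(t)) = U_t` in the sense `lim_{z → γ(t)} g_t(z) = U_t`";
  Thm. 4.6 / Remark 4.5: the capacity parametrisation `hcap(K_t) = 2t`);
* T. Kennedy, *Computing the Loewner driving process of random curves in the half plane*,
  J. Stat. Phys. 131 (2008) [Kennedy2008Driving], §3: for lattice sites `z₀, z₁, …, z_n` along the
  curve, "let `2Δt_i` be the capacity of the map `h_i`, and `ΔU_i` the final value of the driving
  function for `h_i` … `t = Σ Δt_i`, `U_t = Σ ΔU_i`" — the one-step increments of capacity time and
  driving value defined here (`capIncrement`, `drivingIncrement`);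
* G. F. Lawler, O. Schramm, W. Werner, *Conformal restriction: the chordal case*, JAMS 16 (2003)
  [LawlerSchrammWerner2003Restriction], §2 p. 8 ("Fillings", `Fill_ℍ`), §5 (for a hull `A` and
  `t < T_A`: `A_t = g_t(A)`, `h_t := g̃_t ∘ g_A ∘ g_t⁻¹ = g_{A_t}`, `W̃_t = h_t(W_t)`, and the
  derivatives `h_t'(W_t)`, `h_t''(W_t)`, `h_t'''(W_t)` entering
  `d[h_t'(W_t)] = h_t'' dW_t + (h_t''²/(2h_t') + (κ/2 - 4/3) h_t''') dt`), Prop. 4.1 (Virág: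
  `P[Brownian excursion avoids A] = Φ_A'(0)`, so `h'(ξ)` is an excursion-avoidance probability).

## Contents

Half-plane level (namespace `Literature.Probability.RandomPlanarGeometry`):

* `stemArc z₀` — the hyperbolic geodesic of `ℍ` from `z₀` to the boundary point `0` (the preimage
  of the vertical ray above `-1/z₀` under the isometry `w ↦ -1/w`, `neg_inv_mem_upRay_of_mem_stemArc`);
  it attaches the pulled-back path (which starts at the interior point `z₀ = φ⁻¹(δ a_δ)`) to `ℝ` in
  a way that is natural under the dilations `z ↦ c z` relating chordal uniformizing maps;
* `HasHydroMap K`, `hydroEquiv K h`, `hydroFun K` — existence / a choice of the hydrodynamically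
  normalized map `g_K : ℍ ∖ K → ℍ` (`IsHydrodynamicMap`, `HydrodynamicMaps`), the choice being
  immaterial on `ℍ ∖ K` (`hydroEquiv_eqOn`, uniqueness of `g_K`); `hydroFun K : ℂ → ℂ` is its Schwarz
  reflection / boundary extension (`IsHydrodynamicMap.reflExt`; `id` when no such map exists);
  every bounded hull `K ∈ 𝒬` has one (`IsBoundedHull.hasHydroMap`, by translating a `*`-hull);
* `hcapOf K` — `hcap(K)` computed with the chosen map (`= hcap K φ` for EVERY hydrodynamic `φ`,
  `hcapOf_eq`; monotone, `hcapOf_mono`, Lawler (3.8));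
* `tipValue K p` — the boundary value `lim_{z → p, z ∈ ℍ ∖ K} g_K(z)` (real part; junk `0` when
  `p ∉ closure (ℍ ∖ K)` or the limit does not exist), Lawler's `U_t` at `p = γ(t)`;
* `obstacleHull K A = Fill_ℍ (closure (g_K ((ℍ ∖ K) ∩ A)))` — [LSW]'s `A_t = g_t(A)` re-attached
  to `ℝ` and filled (so that pockets enclosed between the path and the obstacle are swallowed).

Lattice level (namespace `Literature.Probability.RandomPlanarGeometry.LatticeSlit`), for
`φ : ConformalEquiv ℍ D.carrier` and a walk `η : (discreteDomainGraph D.carrier δ).Walk a w`: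

* `trace φ η = φ⁻¹(polyline(η) ∩ D)`, `pastSet φ η = closure (stemArc (φ⁻¹(δa)) ∪ trace φ η)`,
  `pastHull φ η = Fill_ℍ (pastSet φ η)` — the hull `K_η`;
* `capTime φ η = hcap(K_η)/2` — the CAPACITY TIME `t_η` of the past, in the Loewner clock
  `hcap(K_t) = 2t` of Lawler Thm. 4.6 / [LSW] §5 (`Loewner.hcap_hull_eq`); the raw capacity is
  `hcapOf (pastHull φ η)`;
* `tipPt φ η = φ⁻¹(δ w)`, `drivingValue φ η = ξ_η = g_{K_η}(tip)` (`tipValue`);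
* `capIncrement φ η u = t_{ηu} - t_η`, `drivingIncrement φ η u = ξ_{ηu} - ξ_η` for a lattice
  neighbour `u` of the tip (`η.concat`), junk `0` if `u` is not adjacent to `w` in `Ω_δ`;
* `obstacleMap φ η D' = h_η`, the (reflected) hydrodynamic map of
  `obstacleHull K_η (φ.pullbackHull D')` for a subdomain `D'` ([LSW] `h_t = g_{A_t}`),
  `obstacleDeriv φ η D' k = Re h_η^{(k)}(ξ_η)` and `avoidProb φ η D' = h_η'(ξ_η)`.

## Junk conventions

All objects are total. `hydroFun K = id`, `hcapOf K = 0` when `ℍ ∖ K` carries no hydrodynamic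
map (e.g. `ℍ ∖ K` not simply connected); `tipValue K p = 0` off `closure (ℍ ∖ K)` or when `g_K`
has no limit at `p` (a swallowed or two-sided tip); increments are `0` for non-neighbours;
`φ.symm` is junk off `D.carrier` (so `trace` only uses `polyline ∩ D`, and a tip `w` with
`δ w ∉ D` gives junk). For `δ ≤ 0` the lattice objects are those of the junk graph
`discreteDomainGraph D.carrier δ`.
-/

noncomputable section

open Set Filter Topology Metric Bornology Complex
open UpperHalfPlane (upperHalfPlaneSet isOpen_upperHalfPlaneSet)
open Literature.Probability.LatticeModels (meshPoint discreteDomainGraph Site)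

namespace Literature.Probability.RandomPlanarGeometry

/-! ### The stem: the hyperbolic geodesic of `ℍ` from `z₀` down to the boundary point `0` -/

/-- **The stem of `z₀`**: the arc `{z₀ / (1 - t z₀ i) : t ≥ 0}`, i.e. the set of `w` with
`-1/w = -1/z₀ + i t`, `t ≥ 0` — the preimage of the vertical ray above `-1/z₀` under the
hyperbolic isometry `w ↦ -1/w` of `ℍ`, hence (for `z₀ ∈ ℍ`) the hyperbolic geodesic ray from `z₀`
to the boundary point `0`; it lies in `ℍ ∩ B̄(0, |z₀|)` and accumulates exactly at `0` on `ℝ`.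
Used to attach a path starting at an interior point `z₀` to the boundary point `0` in a
dilation-equivariant way. [folklore] -/
def stemArc (z₀ : ℂ) : Set ℂ :=
  (fun t : ℝ ↦ z₀ / (1 - t * z₀ * I)) '' Ici 0

section Stem

variable {z₀ w : ℂ} {t : ℝ}

/-- Membership in the stem, unfolded. [folklore] -/
theorem mem_stemArc_iff : w ∈ stemArc z₀ ↔ ∃ t : ℝ, 0 ≤ t ∧ z₀ / (1 - t * z₀ * I) = w := by
  simp only [stemArc, mem_image, mem_Ici]

/-- `z₀` is on its stem (`t = 0`). [folklore] -/
theorem self_mem_stemArc (z₀ : ℂ) : z₀ ∈ stemArc z₀ :=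
  mem_stemArc_iff.2 ⟨0, le_rfl, by simp⟩

/-- Real part of the denominator `1 - t z₀ i`. [folklore] -/
theorem stem_den_re (z₀ : ℂ) (t : ℝ) : (1 - t * z₀ * I).re = 1 + t * z₀.im := by
  simp [mul_re, mul_im]

/-- Imaginary part of the denominator `1 - t z₀ i`. [folklore] -/
theorem stem_den_im (z₀ : ℂ) (t : ℝ) : (1 - t * z₀ * I).im = -(t * z₀.re) := by
  simp [mul_re, mul_im]

/-- For `Im z₀ ≥ 0` and `t ≥ 0` the denominator has norm at least `1`. [folklore] -/
theorem one_le_norm_stem_den (hz₀ : 0 ≤ z₀.im) (ht : 0 ≤ t) : 1 ≤ ‖1 - t * z₀ * I‖ := by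
  have h1 : (1 : ℝ) ≤ |(1 - t * z₀ * I).re| := by
    rw [stem_den_re]
    have : 0 ≤ t * z₀.im := mul_nonneg ht hz₀
    rw [abs_of_nonneg (by linarith)]
    linarith
  exact h1.trans (Complex.abs_re_le_norm _)

/-- The denominator does not vanish (`Im z₀ ≥ 0`, `t ≥ 0`). [folklore] -/
theorem stem_den_ne_zero (hz₀ : 0 ≤ z₀.im) (ht : 0 ≤ t) : 1 - t * z₀ * I ≠ 0 := by
  intro h
  have := one_le_norm_stem_den hz₀ ht
  rw [h, norm_zero] at this
  exact absurd this (by norm_num)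

/-- **The stem lies in `B̄(0, |z₀|)`** (`Im z₀ ≥ 0`). [folklore] -/
theorem stemArc_subset_closedBall (hz₀ : 0 ≤ z₀.im) : stemArc z₀ ⊆ closedBall 0 ‖z₀‖ := by
  rintro w hw
  obtain ⟨t, ht, rfl⟩ := mem_stemArc_iff.1 hw
  rw [mem_closedBall, dist_zero_right, norm_div]
  exact div_le_self (norm_nonneg _) (one_le_norm_stem_den hz₀ ht)

/-- The stem is bounded (`Im z₀ ≥ 0`). [folklore] -/
theorem isBounded_stemArc (hz₀ : 0 ≤ z₀.im) : IsBounded (stemArc z₀) :=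
  isBounded_closedBall.subset (stemArc_subset_closedBall hz₀)

/-- **The stem lies in `ℍ`** when `z₀ ∈ ℍ`: `Im (z₀ / (1 - t z₀ i)) = (Im z₀ + t |z₀|²)/|1 - t z₀ i|²`.
[folklore] -/
theorem stemArc_subset_upperHalfPlaneSet (hz₀ : 0 < z₀.im) : stemArc z₀ ⊆ upperHalfPlaneSet := by
  rintro w hw
  obtain ⟨t, ht, rfl⟩ := mem_stemArc_iff.1 hw
  have hden := stem_den_ne_zero hz₀.le ht
  have hn : 0 < normSq (1 - t * z₀ * I) := normSq_pos.2 hden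
  show 0 < (z₀ / (1 - t * z₀ * I)).im
  rw [div_im, stem_den_re, stem_den_im]
  have h1 : z₀.im * (1 + t * z₀.im) / normSq (1 - ↑t * z₀ * I) -
      z₀.re * -(t * z₀.re) / normSq (1 - ↑t * z₀ * I) =
      (z₀.im + t * (z₀.re ^ 2 + z₀.im ^ 2)) / normSq (1 - ↑t * z₀ * I) := by
    field_simp
    ring
  rw [h1]
  exact div_pos (by positivity) hn

/-- **The stem is an arc of a geodesic**: `-1/w = -1/z₀ + i t` for `w = z₀/(1 - t z₀ i)`
(`z₀ ≠ 0`). [folklore] -/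
theorem neg_inv_stem_point (hz : z₀ ≠ 0) (t : ℝ) :
    -(z₀ / (1 - t * z₀ * I))⁻¹ = -z₀⁻¹ + t * I := by
  rw [inv_div]
  field_simp
  ring

/-- The stem is the preimage of the vertical ray `upRay (-1/z₀)` under `w ↦ -1/w`
(`z₀ ∈ ℍ`). [folklore] -/
theorem neg_inv_mem_upRay_of_mem_stemArc (hz₀ : 0 < z₀.im) (hw : w ∈ stemArc z₀) :
    -w⁻¹ ∈ upRay (-z₀⁻¹) := by
  obtain ⟨t, ht, rfl⟩ := mem_stemArc_iff.1 hw
  have hz : z₀ ≠ 0 := by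
    rintro rfl
    simp at hz₀
  refine ⟨t, mem_Ici.2 ht, ?_⟩
  rw [neg_inv_stem_point hz t]

/-- The parametrisation of the stem is continuous on `[0, ∞)` (`Im z₀ ≥ 0`). [folklore] -/
theorem continuousOn_stem_param (hz₀ : 0 ≤ z₀.im) :
    ContinuousOn (fun t : ℝ ↦ z₀ / (1 - t * z₀ * I)) (Ici 0) := by
  refine continuousOn_const.div (Continuous.continuousOn (by fun_prop)) fun t ht ↦ ?_
  exact stem_den_ne_zero hz₀ ht

/-- **The stem is connected** (`Im z₀ ≥ 0`). [folklore] -/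
theorem isConnected_stemArc (hz₀ : 0 ≤ z₀.im) : IsConnected (stemArc z₀) :=
  isConnected_Ici.image _ (continuousOn_stem_param hz₀)

/-- **The stem accumulates at `0`**: `z₀/(1 - t z₀ i) → 0` as `t → ∞` (`z₀ ∈ ℍ`). [folklore] -/
theorem tendsto_stem_param_atTop (hz₀ : 0 < z₀.im) :
    Tendsto (fun t : ℝ ↦ z₀ / (1 - t * z₀ * I)) atTop (𝓝 0) := by
  -- `‖z₀ / (1 - t z₀ i)‖ ≤ ‖z₀‖ / (1 + t Im z₀)`
  have hbound : ∀ t : ℝ, 0 ≤ t → ‖z₀ / (1 - t * z₀ * I)‖ ≤ ‖z₀‖ / (1 + t * z₀.im) := by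
    intro t ht
    rw [norm_div]
    have h1 : 1 + t * z₀.im ≤ ‖1 - t * z₀ * I‖ := by
      have := Complex.abs_re_le_norm (1 - t * z₀ * I)
      rw [stem_den_re] at this
      exact (le_abs_self _).trans this
    have h2 : 0 < 1 + t * z₀.im := by positivity
    exact div_le_div_of_nonneg_left (norm_nonneg _) h2 h1
  have hlim : Tendsto (fun t : ℝ ↦ ‖z₀‖ / (1 + t * z₀.im)) atTop (𝓝 0) := by
    refine tendsto_const_nhds.div_atTop ?_
    exact tendsto_atTop_add_const_left _ _ (tendsto_id.atTop_mul_const hz₀)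
  rw [tendsto_zero_iff_norm_tendsto_zero]
  refine squeeze_zero_norm' ?_ hlim
  filter_upwards [eventually_ge_atTop 0] with t ht
  rw [Real.norm_of_nonneg (norm_nonneg _)]
  exact hbound t ht

/-- `0` lies in the closure of the stem (`z₀ ∈ ℍ`), so `closure (stemArc z₀)` is attached to `ℝ`
at the origin. [folklore] -/
theorem zero_mem_closure_stemArc (hz₀ : 0 < z₀.im) : (0 : ℂ) ∈ closure (stemArc z₀) := by
  refine mem_closure_of_tendsto (tendsto_stem_param_atTop hz₀) ?_
  filter_upwards [eventually_ge_atTop 0] with t ht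
  exact ⟨t, mem_Ici.2 ht, rfl⟩

/-- **Dilation equivariance of the stem**: `stemArc (c z₀) = c · stemArc z₀` for `c > 0` (the
dilations `z ↦ c z` are the hyperbolic isometries fixing `0` and `∞`, i.e. the ambiguity in a
chordal uniformizing map; reparametrize `t ↦ c t`). [folklore] -/
theorem stemArc_mul (z₀ : ℂ) {c : ℝ} (hc : 0 < c) :
    stemArc (c * z₀) = (fun w ↦ (c : ℂ) * w) '' stemArc z₀ := by
  ext w
  simp only [mem_stemArc_iff, mem_image]
  constructor
  · rintro ⟨t, ht, rfl⟩
    refine ⟨z₀ / (1 - (c * t : ℝ) * z₀ * I), ⟨c * t, by positivity, rfl⟩, ?_⟩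
    push_cast
    rw [mul_div_assoc']
    congr 1
    ring
  · rintro ⟨_, ⟨t, ht, rfl⟩, rfl⟩
    refine ⟨t / c, by positivity, ?_⟩
    have hc' : (c : ℂ) ≠ 0 := by exact_mod_cast hc.ne'
    have hkey : ((t / c : ℝ) : ℂ) * (c * z₀) = t * z₀ := by
      push_cast
      field_simp
    rw [mul_div_assoc', hkey]

end Stem

/-! ### Canonical hydrodynamically normalized maps `g_K` -/

section Hydro

variable {K : Set ℂ}

/-- **`ℍ ∖ K` carries a hydrodynamically normalized conformal map onto `ℍ`**: some conformal
equivalence `φ : ℍ ∖ K → ℍ` has `φ(z) - z → 0` at `∞` (Lawler (2005), Prop. 3.36: for a bounded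
hull `A ∈ 𝒬` "there is a unique choice of `g`, which we denote by `g_A`"; `IsBoundedHull.hasHydroMap`).
[cite: Lawler2005, §3.4 Prop. 3.36] -/
def HasHydroMap (K : Set ℂ) : Prop :=
  ∃ φ : ConformalEquiv (upperHalfPlaneSet \ K) upperHalfPlaneSet, IsHydrodynamicMap K φ

/-- **A chosen hydrodynamic map `g_K : ℍ ∖ K → ℍ`** (any two agree on `ℍ ∖ K`, `hydroEquiv_eqOn`).
[cite: Lawler2005, §3.4 Prop. 3.36] -/
def hydroEquiv (K : Set ℂ) (h : HasHydroMap K) :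
    ConformalEquiv (upperHalfPlaneSet \ K) upperHalfPlaneSet :=
  Classical.choose h

/-- The chosen map is hydrodynamically normalized. [folklore] -/
theorem isHydrodynamicMap_hydroEquiv (h : HasHydroMap K) : IsHydrodynamicMap K (hydroEquiv K h) :=
  Classical.choose_spec h

open Classical in
/-- **`g_K` as a function on `ℂ`**: the Schwarz reflection / boundary extension
(`IsHydrodynamicMap.reflExt`: `g_K` on `ℍ ∖ K`, limits from `ℍ ∖ K` on `ℝ ∪ K` where they exist,
`conj ∘ g_K ∘ conj` below) of the chosen hydrodynamic map; the identity when there is none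
(junk). [cite: Lawler2005, §3.4 Prop. 3.36 (with the Schwarz reflection of its proof)] -/
def hydroFun (K : Set ℂ) : ℂ → ℂ :=
  if h : HasHydroMap K then IsHydrodynamicMap.reflExt (hydroEquiv K h) else id

open Classical in
/-- **The half-plane capacity `hcap(K)`** computed with the chosen map (Lawler (2005),
Def. 3.37: `hcap(A) = lim_{z → ∞} z [g_A(z) - z]`); it equals `hcap K φ` for every hydrodynamic
`φ` (`hcapOf_eq`); junk `0` without a hydrodynamic map. [cite: Lawler2005, §3.4 Def. 3.37] -/
def hcapOf (K : Set ℂ) : ℝ :=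
  if h : HasHydroMap K then hcap K (hydroEquiv K h) else 0

open Classical in
/-- **The boundary value of `g_K` at a boundary point `p` of `ℍ ∖ K`** (real part of
`lim_{z → p, z ∈ ℍ ∖ K} g_K(z)`): for the tip `p = γ(t)` of a slit this is Lawler's `U_t`
("there is a unique `U_t ∈ ℝ` with `g_t(γ(t)) = U_t` in the sense `lim_{z → γ(t)} g_t(z) = U_t`",
Lemma 4.2), i.e. the image of the prime end of `ℍ ∖ K` at `p` when that prime end is unique.
Junk: `0` when `p ∉ closure (ℍ ∖ K)` (swallowed point) or when the limit does not exist (a tip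
with two prime ends); `Re p` in the degenerate case that `K` has no hydrodynamic map at all
(`hydroFun K = id`). [cite: Lawler2005, §4.1 Lemma 4.2] -/
def tipValue (K : Set ℂ) (p : ℂ) : ℝ :=
  if h : p ∈ closure (upperHalfPlaneSet \ K) ∧
      ∃ c : ℂ, Tendsto (hydroFun K) (𝓝[upperHalfPlaneSet \ K] p) (𝓝 c)
  then (Classical.choose h.2).re else 0

/-- **The image of an obstacle**: for an obstacle `A` (a hull attached to `ℝ`), the set
`Fill_ℍ (closure (g_K ((ℍ ∖ K) ∩ A)))` — [LSW] §5's `A_t = g_t(A)` for the hull `K = K_t`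
(there `K_t ∩ A = ∅`), re-attached to `ℝ` by the closure and with the pockets enclosed between
`K` and `A` filled in (`hpFill`, [LSW] §2 "Fillings"), so that it is again a hull whenever
`g_K(A ∖ K)` is bounded. [cite: LawlerSchrammWerner2003Restriction, §5 (A_t = g_t(A)) with §2 p. 8 (Fillings)] -/
def obstacleHull (K A : Set ℂ) : Set ℂ :=
  hpFill (closure (hydroFun K '' ((upperHalfPlaneSet \ K) ∩ A)))

/-! #### Unfolding and independence of the choice -/

/-- `hydroFun` unfolded: the reflected extension of the chosen map. [folklore] -/
theorem hydroFun_eq_reflExt (h : HasHydroMap K) :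
    hydroFun K = IsHydrodynamicMap.reflExt (hydroEquiv K h) := by
  rw [hydroFun, dif_pos h]

/-- Without a hydrodynamic map, `hydroFun` is the identity (junk). [folklore] -/
theorem hydroFun_of_not (h : ¬ HasHydroMap K) : hydroFun K = id := by
  rw [hydroFun, dif_neg h]

/-- On `ℍ ∖ K`, `hydroFun K` is the chosen conformal map. [folklore] -/
theorem hydroFun_apply (h : HasHydroMap K) {z : ℂ} (hz : z ∈ upperHalfPlaneSet \ K) :
    hydroFun K z = hydroEquiv K h z := by
  rw [hydroFun_eq_reflExt h, IsHydrodynamicMap.reflExt_eq hz]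

/-- `hcapOf` unfolded. [folklore] -/
theorem hcapOf_of_hasHydroMap (h : HasHydroMap K) : hcapOf K = hcap K (hydroEquiv K h) := by
  rw [hcapOf, dif_pos h]

/-- Without a hydrodynamic map, `hcapOf K = 0` (junk). [folklore] -/
theorem hcapOf_of_not (h : ¬ HasHydroMap K) : hcapOf K = 0 := by
  rw [hcapOf, dif_neg h]

/-- **Uniqueness of `g_K`**: the chosen map agrees on `ℍ ∖ K` with every hydrodynamic map of `K`
(`K ∩ ℍ` bounded; Lawler (2005), Prop. 3.36, via `IsHydrodynamicMap.eqOn_of_isHydrodynamicMap`).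
[cite: Lawler2005, §3.4 Prop. 3.36] -/
theorem hydroEquiv_eqOn (h : HasHydroMap K)
    {φ : ConformalEquiv (upperHalfPlaneSet \ K) upperHalfPlaneSet} (hφ : IsHydrodynamicMap K φ)
    (hb : IsBounded (K ∩ upperHalfPlaneSet)) : EqOn (hydroEquiv K h) φ (upperHalfPlaneSet \ K) :=
  (isHydrodynamicMap_hydroEquiv h).eqOn_of_isHydrodynamicMap hφ hb

/-- `hydroFun K = φ` on `ℍ ∖ K` for every hydrodynamic `φ` (`K ∩ ℍ` bounded). [folklore] -/
theorem hydroFun_eqOn {φ : ConformalEquiv (upperHalfPlaneSet \ K) upperHalfPlaneSet}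
    (hφ : IsHydrodynamicMap K φ) (hb : IsBounded (K ∩ upperHalfPlaneSet)) :
    EqOn (hydroFun K) φ (upperHalfPlaneSet \ K) := fun z hz ↦ by
  rw [hydroFun_apply ⟨φ, hφ⟩ hz]
  exact hydroEquiv_eqOn ⟨φ, hφ⟩ hφ hb hz

/-- **`hcapOf K` is the half-plane capacity**: it equals `hcap K φ` for every hydrodynamic map
`φ` of `K` (`K ∩ ℍ` bounded) — both are the limit of `z (φ(z) - z)` at `∞` in `ℍ ∖ K`, where the
maps agree. [cite: Lawler2005, §3.4 Def. 3.37] -/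
theorem hcapOf_eq {φ : ConformalEquiv (upperHalfPlaneSet \ K) upperHalfPlaneSet}
    (hφ : IsHydrodynamicMap K φ) (hb : IsBounded (K ∩ upperHalfPlaneSet)) : hcapOf K = hcap K φ := by
  have h : HasHydroMap K := ⟨φ, hφ⟩
  rw [hcapOf_of_hasHydroMap h]
  haveI := IsHydrodynamicMap.neBot_cocompact_inf hb
  have h1 := (isHydrodynamicMap_hydroEquiv h).tendsto_mul_sub_self hb
  have h2 := hφ.tendsto_mul_sub_self hb
  have h3 : Tendsto (fun z ↦ z * (φ z - z)) (cocompact ℂ ⊓ 𝓟 (upperHalfPlaneSet \ K))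
      (𝓝 (hcap K (hydroEquiv K h) : ℂ)) := by
    refine h1.congr' ?_
    filter_upwards [mem_inf_of_right (mem_principal_self _)] with z hz
    rw [hydroEquiv_eqOn h hφ hb hz]
  exact_mod_cast tendsto_nhds_unique h3 h2

/-- **`hcap ≥ 0`** (`K ∩ ℍ` bounded; trivially in the junk case). [cite: Lawler2005, §3.4 (3.8)] -/
theorem hcapOf_nonneg (hb : IsBounded (K ∩ upperHalfPlaneSet)) : 0 ≤ hcapOf K := by
  by_cases h : HasHydroMap K
  · rw [hcapOf_of_hasHydroMap h]
    exact (isHydrodynamicMap_hydroEquiv h).hcap_nonneg hb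
  · rw [hcapOf_of_not h]

/-- **Monotonicity of the half-plane capacity** (Lawler (2005), (3.8): for hulls `A ⊆ A'`,
`hcap(A') = hcap(A) + hcap(g_A(A' ∖ A)) ≥ hcap(A)`): if `ℍ ∖ K₂ ⊆ ℍ ∖ K₁` and both carry
hydrodynamic maps, `hcap(K₁) ≤ hcap(K₂)` (additivity `IsHydrodynamicMap.hcap_diffQuotient` and
positivity of the capacity of the quotient hull). [cite: Lawler2005, §3.4 (3.8)] -/
theorem hcapOf_mono {K₁ K₂ : Set ℂ} (h₁ : HasHydroMap K₁) (h₂ : HasHydroMap K₂)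
    (hb₁ : IsBounded (K₁ ∩ upperHalfPlaneSet)) (hb₂ : IsBounded (K₂ ∩ upperHalfPlaneSet))
    (h12 : upperHalfPlaneSet \ K₂ ⊆ upperHalfPlaneSet \ K₁) : hcapOf K₁ ≤ hcapOf K₂ := by
  rw [hcapOf_of_hasHydroMap h₁, hcapOf_of_hasHydroMap h₂]
  have hφ₁ := isHydrodynamicMap_hydroEquiv h₁
  have hφ₂ := isHydrodynamicMap_hydroEquiv h₂
  have hq := hφ₁.hcap_diffQuotient hφ₂ hb₁ hb₂ h12
  have hnn := (hφ₁.diffQuotient hφ₂ hb₁ h12).hcap_nonneg (hφ₁.isBounded_diffImage hb₁ hb₂)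
  rw [hq] at hnn
  linarith

/-- **`tipValue` is the boundary limit**: if some hydrodynamic map `φ` of `K` (`K ∩ ℍ` bounded)
tends to `c` at `p ∈ closure (ℍ ∖ K)` from inside `ℍ ∖ K`, then `tipValue K p = Re c` (the maps
agree on `ℍ ∖ K`, and limits within `ℍ ∖ K` at `p` are unique). [cite: Lawler2005, §4.1 Lemma 4.2] -/
theorem tipValue_eq {φ : ConformalEquiv (upperHalfPlaneSet \ K) upperHalfPlaneSet}
    (hφ : IsHydrodynamicMap K φ) (hb : IsBounded (K ∩ upperHalfPlaneSet)) {p c : ℂ}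
    (hp : p ∈ closure (upperHalfPlaneSet \ K)) (hc : Tendsto φ (𝓝[upperHalfPlaneSet \ K] p) (𝓝 c)) :
    tipValue K p = c.re := by
  have hc' : Tendsto (hydroFun K) (𝓝[upperHalfPlaneSet \ K] p) (𝓝 c) :=
    hc.congr' (eventually_nhdsWithin_of_forall fun z hz ↦ (hydroFun_eqOn hφ hb hz).symm)
  have hex : ∃ c : ℂ, Tendsto (hydroFun K) (𝓝[upperHalfPlaneSet \ K] p) (𝓝 c) := ⟨c, hc'⟩
  rw [tipValue, dif_pos ⟨hp, hex⟩]
  haveI : (𝓝[upperHalfPlaneSet \ K] p).NeBot := mem_closure_iff_nhdsWithin_neBot.1 hp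
  show (Classical.choose hex).re = c.re
  rw [tendsto_nhds_unique (Classical.choose_spec hex) hc']

/-- **`hydroFun` carries the boundary values of `g_K`**: at a point `p` of the closed upper
half-plane lying in `closure (ℍ ∖ K)`, where the chosen map tends to `c` from inside `ℍ ∖ K`,
`hydroFun K p = c` (`extendFrom`). [cite: Lawler2005, §4.1 Lemma 4.2] -/
theorem hydroFun_eq_of_tendsto (h : HasHydroMap K) {p c : ℂ}
    (hp : p ∈ closure (upperHalfPlaneSet \ K)) (hpim : 0 ≤ p.im)
    (hc : Tendsto (hydroEquiv K h) (𝓝[upperHalfPlaneSet \ K] p) (𝓝 c)) : hydroFun K p = c := by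
  rw [hydroFun_eq_reflExt h, IsHydrodynamicMap.reflExt, Complex.schwarzReflection_of_nonneg hpim]
  exact extendFrom_eq hp hc

/-- Hence **`tipValue K p = Re (hydroFun K p)`** at such a point: the driving value is literally
the (extended) hydrodynamic map evaluated at the tip. [cite: Lawler2005, §4.1 Lemma 4.2] -/
theorem tipValue_eq_re_hydroFun (h : HasHydroMap K) (hb : IsBounded (K ∩ upperHalfPlaneSet))
    {p c : ℂ} (hp : p ∈ closure (upperHalfPlaneSet \ K)) (hpim : 0 ≤ p.im)
    (hc : Tendsto (hydroEquiv K h) (𝓝[upperHalfPlaneSet \ K] p) (𝓝 c)) :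
    tipValue K p = (hydroFun K p).re := by
  rw [tipValue_eq (isHydrodynamicMap_hydroEquiv h) hb hp hc, hydroFun_eq_of_tendsto h hp hpim hc]

/-- Off `closure (ℍ ∖ K)` (a swallowed point) the tip value is the junk `0`. [folklore] -/
theorem tipValue_of_notMem_closure {p : ℂ} (hp : p ∉ closure (upperHalfPlaneSet \ K)) :
    tipValue K p = 0 := by
  rw [tipValue, dif_neg]
  exact fun h ↦ hp h.1

/-! #### Existence of hydrodynamic maps -/

/-- The identity `ℍ ∖ ∅ → ℍ` is hydrodynamic: **the empty hull has a hydrodynamic map**. [folklore] -/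
theorem hasHydroMap_empty : HasHydroMap (∅ : Set ℂ) :=
  ⟨restrictionMapEmpty, by
    change Tendsto (fun z : ℂ ↦ restrictionMapEmpty z - z) _ _
    simp only [restrictionMapEmpty_apply, sub_self]
    exact tendsto_const_nhds⟩

/-- **`hcap(∅) = 0`.** [cite: Lawler2005, §3.4 Def. 3.37] -/
theorem hcapOf_empty : hcapOf (∅ : Set ℂ) = 0 := by
  have hφ : IsHydrodynamicMap ∅ restrictionMapEmpty := by
    change Tendsto (fun z : ℂ ↦ restrictionMapEmpty z - z) _ _
    simp only [restrictionMapEmpty_apply, sub_self]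
    exact tendsto_const_nhds
  have hb : IsBounded ((∅ : Set ℂ) ∩ upperHalfPlaneSet) := by simp
  rw [hcapOf_eq hφ hb]
  haveI := IsHydrodynamicMap.neBot_cocompact_inf hb
  have h1 := hφ.tendsto_mul_sub_self hb
  have h2 : Tendsto (fun z : ℂ ↦ z * (restrictionMapEmpty z - z))
      (cocompact ℂ ⊓ 𝓟 (upperHalfPlaneSet \ ∅)) (𝓝 0) := by
    simp only [restrictionMapEmpty_apply, sub_self, mul_zero]
    exact tendsto_const_nhds
  exact_mod_cast tendsto_nhds_unique h1 h2

/-- **Every `*`-hull has a hydrodynamic map**: `g_B = Φ_B - L_B` with `Φ_B` a restriction map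
(`IsStarHull.exists_isRestrictionMap`) and `L_B = lim (Φ_B(z) - z)` (`hullShift`,
`tendsto_hullExt_sub_self`); [LSW] §2: "`Φ_A(z) = g_A(z) - g_A(0)`".
[cite: LawlerSchrammWerner2003Restriction, §2 pp. 7–8 (g_A, Φ_A)] -/
theorem IsStarHull.hasHydroMap {B : Set ℂ} (hB : IsStarHull B) : HasHydroMap B := by
  obtain ⟨Φ, hΦ⟩ := hB.exists_isRestrictionMap
  refine ⟨Φ.trans (addRealUpperHalfPlane (-(hullShift Φ).re)), ?_⟩
  have hL := tendsto_hullExt_sub_self hB.isBoundedHull hΦ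
  have hreal : (((hullShift Φ).re : ℝ) : ℂ) = hullShift Φ :=
    Complex.ext (by simp) (by simp [hullShift_im hB.isBoundedHull hΦ])
  change Tendsto (fun z ↦ (Φ.trans (addRealUpperHalfPlane (-(hullShift Φ).re))) z - z) _ _
  have h1 : Tendsto (fun z ↦ hullExt Φ z - z - hullShift Φ)
      (cocompact ℂ ⊓ 𝓟 (upperHalfPlaneSet \ B)) (𝓝 0) := by
    have := (hL.sub_const (hullShift Φ)).mono_left (inf_le_left (b := 𝓟 (upperHalfPlaneSet \ B)))
    rwa [sub_self] at this
  refine h1.congr' ?_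
  filter_upwards [mem_inf_of_right (mem_principal_self _)] with z hz
  rw [hullExt_of_mem_diff hz, ConformalEquiv.trans_apply, addRealUpperHalfPlane_apply]
  push_cast
  rw [hreal]
  ring

/-- The real translation `z ↦ z + c` as a conformal equivalence `ℍ ∖ K → ℍ ∖ (K + c)`
(Lawler (2005), p. 69: `g_{A+x}(z) = g_A(z - x) + x`). [cite: Lawler2005, §3.4 p. 69] -/
def translateDiff (K : Set ℂ) (c : ℝ) :
    ConformalEquiv (upperHalfPlaneSet \ K) (upperHalfPlaneSet \ ((fun z ↦ z + (c : ℂ)) '' K)) where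
  toFun z := z + c
  invFun z := z - c
  source := upperHalfPlaneSet \ K
  target := upperHalfPlaneSet \ ((fun z ↦ z + (c : ℂ)) '' K)
  map_source' := by
    rintro z ⟨hz, hzK⟩
    refine ⟨show 0 < (z + c).im by simpa using hz, ?_⟩
    rintro ⟨w, hw, hwz⟩
    have : w = z := by simpa using hwz
    exact hzK (this ▸ hw)
  map_target' := by
    rintro z ⟨hz, hzK⟩
    refine ⟨show 0 < (z - c).im by simpa using hz, fun h ↦ hzK ⟨z - c, h, by ring⟩⟩
  left_inv' z _ := by ring
  right_inv' z _ := by ring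
  source_eq := rfl
  target_eq := rfl
  differentiableOn := differentiableOn_id.add_const _
  differentiableOn_symm := differentiableOn_id.sub_const _

/-- The translation acts as `z ↦ z + c`. [folklore] -/
@[simp] theorem translateDiff_apply (K : Set ℂ) (c : ℝ) (z : ℂ) : translateDiff K c z = z + c := rfl

/-- **Transport of hydrodynamic maps along real translations**: if `K + c` has a hydrodynamic map
`g`, then `z ↦ g(z + c) - c` is one for `K` (Lawler (2005), p. 69: `g_{A+x}(z) = g_A(z - x) + x`).
[cite: Lawler2005, §3.4 p. 69] -/
theorem HasHydroMap.of_translate (c : ℝ) (h : HasHydroMap ((fun z ↦ z + (c : ℂ)) '' K)) :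
    HasHydroMap K := by
  obtain ⟨ψ, hψ⟩ := h
  refine ⟨((translateDiff K c).trans ψ).trans (addRealUpperHalfPlane (-c)), ?_⟩
  -- `z + c → ∞` in `ℍ ∖ (K + c)` as `z → ∞` in `ℍ ∖ K`
  have hT : Tendsto (fun z : ℂ ↦ z + c) (cocompact ℂ ⊓ 𝓟 (upperHalfPlaneSet \ K))
      (cocompact ℂ ⊓ 𝓟 (upperHalfPlaneSet \ ((fun z ↦ z + (c : ℂ)) '' K))) := by
    refine tendsto_inf.2 ⟨?_, tendsto_principal.2 ?_⟩
    · refine Tendsto.mono_left ?_ inf_le_left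
      rw [← cobounded_eq_cocompact]
      exact tendsto_add_const_cobounded _
    · filter_upwards [mem_inf_of_right (mem_principal_self _)] with z hz
      exact (translateDiff K c).mapsTo hz
  have h1 := (show Tendsto _ _ _ from hψ).comp hT
  change Tendsto (fun z ↦ (((translateDiff K c).trans ψ).trans (addRealUpperHalfPlane (-c))) z - z) _ _
  refine h1.congr' (Eventually.of_forall fun z ↦ ?_)
  simp only [Function.comp_apply, ConformalEquiv.trans_apply, translateDiff_apply,
    addRealUpperHalfPlane_apply]
  push_cast
  ring

/-- **Every bounded hull `K ∈ 𝒬` has a hydrodynamic map `g_K`** (Lawler (2005), Prop. 3.36):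
translate `K` by a real `c` beyond its radius, so that `K + c ∈ 𝒬*` (`IsBoundedHull.image_add_const`,
`0 ∉ K + c`), take `g_{K+c}` (`IsStarHull.hasHydroMap`) and translate back. [cite: Lawler2005, §3.4 Prop. 3.36] -/
theorem IsBoundedHull.hasHydroMap (hK : IsBoundedHull K) : HasHydroMap K := by
  obtain ⟨R, hR⟩ := hK.1.subset_closedBall 0
  set c : ℝ := |R| + 1 with hc
  refine HasHydroMap.of_translate c (IsStarHull.hasHydroMap ⟨hK.image_add_const c, ?_⟩)
  rintro ⟨z, hz, hz0⟩
  have hzR : ‖z‖ ≤ R := by simpa using hR hz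
  have hz' : z = -(c : ℂ) := eq_neg_of_add_eq_zero_left hz0
  rw [hz', norm_neg, Complex.norm_real, Real.norm_eq_abs, hc] at hzR
  have : |(|R| + 1)| = |R| + 1 := abs_of_pos (by positivity)
  linarith [le_abs_self R]

/-- **The fill of an attached bounded closed set has a hydrodynamic map** (`hpFill S ∈ 𝒬`,
`isBoundedHull_hpFill` with the proved criterion `isSimplyConnected_of_isConnected_compl_holds`).
[cite: LawlerSchrammWerner2003Restriction, §2 p. 8 (Fillings)] -/
theorem hasHydroMap_hpFill {S : Set ℂ} (hS : IsClosed S) (hSb : IsBounded S)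
    (hconn : IsConnected (S ∪ {z : ℂ | z.im ≤ 0})) : HasHydroMap (hpFill S) :=
  (isBoundedHull_hpFill isSimplyConnected_of_isConnected_compl_holds hS hSb hconn).hasHydroMap

/-! #### The obstacle hull of an empty past is the obstacle -/

/-- **A bounded hull is its own fill**: `Fill_ℍ(A) = A` for `A ∈ 𝒬` (`ℍ ∖ A` is connected and
unbounded, hence is the unbounded component of itself, and `A = closure (A ∩ ℍ)`).
[cite: LawlerSchrammWerner2003Restriction, §2 p. 8 (Fillings)] -/
theorem IsBoundedHull.hpFill_eq {A : Set ℂ} (hA : IsBoundedHull A) : hpFill A = A := by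
  have hconn : IsPreconnected (upperHalfPlaneSet \ A) := hA.isPreconnected_diff
  -- `ℍ ∖ A` is unbounded: it contains a vertical ray above `A`
  obtain ⟨R, hR⟩ := hA.1.subset_closedBall 0
  obtain ⟨hfar, hfarR⟩ := farPoint_mem R
  have hV : Loewner.unboundedComponent (upperHalfPlaneSet \ A) = upperHalfPlaneSet \ A := by
    refine (Loewner.unboundedComponent_subset _).antisymm fun z hz ↦ ⟨hz, fun hb ↦ ?_⟩
    have hsub : upperHalfPlaneSet \ A ⊆ connectedComponentIn (upperHalfPlaneSet \ A) z :=
      hconn.subset_connectedComponentIn hz Subset.rfl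
    have hray : upRay (((|R| + 1 : ℝ) : ℂ) * I) ⊆ upperHalfPlaneSet \ A := upRay_subset hR hfar hfarR
    exact not_isBounded_upRay _ (hb.subset (hray.trans hsub))
  rw [hpFill, hV, sdiff_sdiff_right_self]
  change closure (upperHalfPlaneSet ∩ A) = A
  rw [inter_comm, hA.closure_inter_eq]

/-- On `ℍ` the extended map of the empty hull is the identity. [folklore] -/
theorem hydroFun_empty_eqOn : EqOn (hydroFun (∅ : Set ℂ)) id (upperHalfPlaneSet \ ∅) := by
  have hφ : IsHydrodynamicMap ∅ restrictionMapEmpty := by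
    change Tendsto (fun z : ℂ ↦ restrictionMapEmpty z - z) _ _
    simp only [restrictionMapEmpty_apply, sub_self]
    exact tendsto_const_nhds
  intro z hz
  rw [hydroFun_eqOn hφ (by simp) hz, restrictionMapEmpty_apply, id]

/-- **With an empty past the obstacle hull is the obstacle**: `obstacleHull ∅ A = A` for
`A ∈ 𝒬` ([LSW] §5 at `t = 0`: `A_0 = g_0(A) = A`). [cite: LawlerSchrammWerner2003Restriction, §5 (A_t = g_t(A))] -/
theorem obstacleHull_empty {A : Set ℂ} (hA : IsBoundedHull A) : obstacleHull ∅ A = A := by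
  have himg : hydroFun (∅ : Set ℂ) '' ((upperHalfPlaneSet \ ∅) ∩ A) = A ∩ upperHalfPlaneSet := by
    rw [(hydroFun_empty_eqOn.mono inter_subset_left).image_eq, image_id, sdiff_empty, inter_comm]
  rw [obstacleHull, himg, hA.closure_inter_eq, hA.hpFill_eq]

end Hydro

/-! ### Lattice slits: the past of a lattice path in half-plane coordinates -/

namespace LatticeSlit

variable {D : DobrushinDomain} (φ : ConformalEquiv upperHalfPlaneSet D.carrier) {δ : ℝ}
  {a w : Site 2}

/-- **The base point `z₀ = φ⁻¹(δ a)`** of a lattice path started at the site `a` (a point of `ℍ`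
when `δ a ∈ D`). [folklore] -/
def basePt (φ : ConformalEquiv upperHalfPlaneSet D.carrier) (δ : ℝ) (a : Site 2) : ℂ :=
  φ.symm (meshPoint δ a)

/-- **The pulled-back trace `φ⁻¹(polyline(η) ∩ D)`** of a walk `η` of `Ω_δ` (the polyline through
the mesh points of `η`, `SimpleGraph.Walk.toCurve`, lies in `closure D`; its part inside `D` is
pulled back to `ℍ`; Lawler (2005), §4.1: the slit `γ(0, t] ⊂ ℍ`). [cite: Lawler2005, §4.1 (p. 94)] -/
def trace (η : (discreteDomainGraph D.carrier δ).Walk a w) : Set ℂ :=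
  φ.symm '' (range (η.toCurve (meshPoint δ)) ∩ D.carrier)

/-- **The generating compact set `S_η = closure (stem ∪ trace)`**: the pulled-back trace attached
to the boundary point `0` by the stem of its initial point `z₀ = φ⁻¹(δ a)` and closed up (the
closure re-attaches to `ℝ` the excursions of the polyline to `∂D`). [folklore] -/
def pastSet (η : (discreteDomainGraph D.carrier δ).Walk a w) : Set ℂ :=
  closure (stemArc (basePt φ δ a) ∪ trace φ η)

/-- **The hull `K_η = Fill_ℍ(S_η)` of the past** ([LSW] §2 p. 8 "Fillings"; for a self-avoiding
path not meeting its stem this is the slit itself, Lawler's `H_t = ℍ ∖ γ[0, t]`).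
[cite: LawlerSchrammWerner2003Restriction, §2 p. 8 (Fillings)] -/
def pastHull (η : (discreteDomainGraph D.carrier δ).Walk a w) : Set ℂ :=
  hpFill (pastSet φ η)

/-- **The capacity time `t_η = hcap(K_η)/2`** of the past: the time at which a chordal Loewner
chain in the capacity parametrisation `hcap(K_t) = 2t` (Lawler (2005), Thm. 4.6 / Remark 4.5;
[LSW] §5; the tree's `Loewner.hcap_hull_eq`) has grown the hull `K_η`; the raw capacity is
`hcapOf (pastHull φ η)` (Def. 3.37). Kennedy (2008), §3: "`t = Σ Δt_i`" with `2Δt_i` the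
capacity of the `i`-th lattice step. [cite: Lawler2005, §4.1 Remark 4.5 with §3.4 Def. 3.37] -/
def capTime (η : (discreteDomainGraph D.carrier δ).Walk a w) : ℝ :=
  hcapOf (pastHull φ η) / 2

/-- **The tip `φ⁻¹(δ w)`** of the walk in `ℍ` (junk if `δ w ∉ D`). [folklore] -/
def tipPt (φ : ConformalEquiv upperHalfPlaneSet D.carrier)
    (_η : (discreteDomainGraph D.carrier δ).Walk a w) : ℂ :=
  φ.symm (meshPoint δ w)

/-- **The driving value `ξ_η = g_{K_η}(tip)`**: the boundary value of the hydrodynamic map of the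
past hull at the tip (Lawler (2005), Lemma 4.2: `U_t = lim_{z → γ(t)} g_t(z)`; Kennedy (2008), §3:
"the value of the driving function at `t` is `U_t = g_s(γ(s))`"), junk `0` when the tip is
swallowed or the limit fails to exist (`tipValue`). [cite: Lawler2005, §4.1 Lemma 4.2] -/
def drivingValue (η : (discreteDomainGraph D.carrier δ).Walk a w) : ℝ :=
  tipValue (pastHull φ η) (tipPt φ η)

open Classical in
/-- **The capacity increment `Δt_u = t_{ηu} - t_η`** of appending the lattice neighbour `u` of the
tip (`η.concat`, an edge of `Ω_δ`); junk `0` if `u` is not adjacent to the tip in `Ω_δ`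
(Kennedy (2008), §3: "let `2Δt_i` be the capacity of the map `h_i`"; Lawler (2005), §4.1 with
(3.8): `hcap(g_s(γ(s, t])) = b(t) - b(s)`). [cite: Kennedy2008Driving, §3] -/
def capIncrement (η : (discreteDomainGraph D.carrier δ).Walk a w) (u : Site 2) : ℝ :=
  if h : (discreteDomainGraph D.carrier δ).Adj w u then capTime φ (η.concat h) - capTime φ η else 0

open Classical in
/-- **The driving increment `Δξ_u = ξ_{ηu} - ξ_η`** of appending the lattice neighbour `u` of the
tip; junk `0` if `u` is not adjacent to the tip in `Ω_δ` (Kennedy (2008), §3: "`ΔU_i` the final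
value of the driving function for `h_i` … `U_t = Σ ΔU_i`"). [cite: Kennedy2008Driving, §3] -/
def drivingIncrement (η : (discreteDomainGraph D.carrier δ).Walk a w) (u : Site 2) : ℝ :=
  if h : (discreteDomainGraph D.carrier δ).Adj w u then
    drivingValue φ (η.concat h) - drivingValue φ η else 0

/-- **The map `h_η = g_{B_η}`** removing the image `B_η = obstacleHull K_η A` of the obstacle
`A = φ.pullbackHull D'` (the pulled-back hull of a subdomain `D' ⊆ D`, `HullSubdomainPullback`),
hydrodynamically normalized and Schwarz-reflected (`hydroFun`): [LSW] §5, "`A_t = g_t(A)`, …,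
`h_t := g̃_t ∘ g_A ∘ g_t⁻¹ = g_{A_t}`", here at the hull `K_η` of a lattice past instead of `K_t`.
[cite: LawlerSchrammWerner2003Restriction, §5 (h_t = g_{A_t})] -/
def obstacleMap (η : (discreteDomainGraph D.carrier δ).Walk a w) (D' : DobrushinDomain) : ℂ → ℂ :=
  hydroFun (obstacleHull (pastHull φ η) (φ.pullbackHull D'))

/-- **The derivatives `h_η^{(k)}(ξ_η)`** (real parts; `h_η` is real-analytic on `ℝ` near `ξ_η`
by Schwarz reflection while the tip is off the obstacle) — [LSW] §5 uses `h_t'(W_t)`,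
`h_t''(W_t)`, `h_t'''(W_t)` in `d[h_t'(W_t)] = h_t''(W_t) dW_t + (h_t''(W_t)²/(2h_t'(W_t)) +
(κ/2 - 4/3) h_t'''(W_t)) dt`. [cite: LawlerSchrammWerner2003Restriction, §5 (displays before Prop. 5.1)] -/
def obstacleDeriv (η : (discreteDomainGraph D.carrier δ).Walk a w) (D' : DobrushinDomain) (k : ℕ) : ℝ :=
  (iteratedDeriv k (obstacleMap φ η D') (drivingValue φ η)).re

/-- **The excursion-avoidance value `q_η = h_η'(ξ_η)`**: by [LSW] Prop. 4.1 (Virág),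
`P[B[0, ∞) ∩ A = ∅] = Φ_A'(0)` for the Brownian excursion `B` from `0` to `∞` in `ℍ`, so
`h_η'(ξ_η) = Φ'_{B_η - ξ_η}(0)` is the probability that a Brownian excursion of `ℍ` from `ξ_η`
avoids `B_η`, i.e. (conformal invariance) that an excursion of `D ∖ η` from the tip to `b` stays
in `D'`; its `5/8`-th power is the SLE_{8/3} value function of the route.
[cite: LawlerSchrammWerner2003Restriction, Prop. 4.1] -/
def avoidProb (η : (discreteDomainGraph D.carrier δ).Walk a w) (D' : DobrushinDomain) : ℝ :=
  obstacleDeriv φ η D' 1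

/-! #### Unfolding lemmas and monotonicity along the walk -/

variable {φ}

/-- `capTime` unfolded: `2 t_η = hcap(K_η)`. [folklore] -/
theorem two_mul_capTime (η : (discreteDomainGraph D.carrier δ).Walk a w) :
    2 * capTime φ η = hcapOf (pastHull φ η) := by
  rw [capTime]; ring

/-- The capacity increment of a neighbour, unfolded. [folklore] -/
theorem capIncrement_of_adj (η : (discreteDomainGraph D.carrier δ).Walk a w) {u : Site 2}
    (h : (discreteDomainGraph D.carrier δ).Adj w u) :
    capIncrement φ η u = capTime φ (η.concat h) - capTime φ η := by
  rw [capIncrement, dif_pos h]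

/-- The driving increment of a neighbour, unfolded. [folklore] -/
theorem drivingIncrement_of_adj (η : (discreteDomainGraph D.carrier δ).Walk a w) {u : Site 2}
    (h : (discreteDomainGraph D.carrier δ).Adj w u) :
    drivingIncrement φ η u = drivingValue φ (η.concat h) - drivingValue φ η := by
  rw [drivingIncrement, dif_pos h]

/-- Non-neighbours have zero increments (junk convention). [folklore] -/
theorem capIncrement_of_not_adj (η : (discreteDomainGraph D.carrier δ).Walk a w) {u : Site 2}
    (h : ¬ (discreteDomainGraph D.carrier δ).Adj w u) : capIncrement φ η u = 0 := by
  rw [capIncrement, dif_neg h]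

/-- Non-neighbours have zero increments (junk convention). [folklore] -/
theorem drivingIncrement_of_not_adj (η : (discreteDomainGraph D.carrier δ).Walk a w) {u : Site 2}
    (h : ¬ (discreteDomainGraph D.carrier δ).Adj w u) : drivingIncrement φ η u = 0 := by
  rw [drivingIncrement, dif_neg h]

/-- `avoidProb` is the first derivative. [folklore] -/
theorem avoidProb_eq (η : (discreteDomainGraph D.carrier δ).Walk a w) (D' : DobrushinDomain) :
    avoidProb φ η D' = (deriv (obstacleMap φ η D') (drivingValue φ η)).re := by
  rw [avoidProb, obstacleDeriv, iteratedDeriv_one]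

end LatticeSlit

/-! #### Polylines grow when a point is appended -/

section PolylineAppend

variable {E : Type*} [AddCommGroup E] [Module ℝ E] [TopologicalSpace E] [ContinuousAdd E]
  [ContinuousSMul ℝ E]

/-- Appending a point to a polyline enlarges its trace. [folklore] -/
theorem range_polylineFrom_subset_append (a : E) (l : List E) (x : E) :
    range (LatticeModels.polylineFrom a l).2 ⊆ range (LatticeModels.polylineFrom a (l ++ [x])).2 := by
  induction l generalizing a with
  | nil =>
    rintro _ ⟨t, rfl⟩
    rw [List.nil_append, LatticeModels.polylineFrom_cons]
    change (Path.refl a) t ∈ range ((Path.segment a x).trans (LatticeModels.polylineFrom x []).2)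
    rw [Path.trans_range, Path.range_segment]
    exact Or.inl (by simpa using left_mem_segment ℝ a x)
  | cons b l ih =>
    rw [List.cons_append, LatticeModels.polylineFrom_cons, LatticeModels.polylineFrom_cons]
    change range ((Path.segment a b).trans (LatticeModels.polylineFrom b l).2) ⊆
      range ((Path.segment a b).trans (LatticeModels.polylineFrom b (l ++ [x])).2)
    rw [Path.trans_range, Path.trans_range]
    exact union_subset_union_right _ (ih b)

/-- **The curve of a walk is an initial piece of the curve of its one-step extension** (as sets).
[folklore] -/
theorem range_toCurve_subset_concat {V : Type*} {G : SimpleGraph V} {u v x : V} (emb : V → E)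
    (p : G.Walk u v) (h : G.Adj v x) :
    range (p.toCurve emb) ⊆ range ((p.concat h).toCurve emb) := by
  change range (LatticeModels.polyline (p.support.map emb)) ⊆
    range (LatticeModels.polyline ((p.concat h).support.map emb))
  rw [SimpleGraph.Walk.support_concat, ← p.cons_tail_support]
  simp only [List.cons_append, List.map_cons, List.map_append, List.map_nil]
  exact range_polylineFrom_subset_append (emb u) (p.support.tail.map emb) (emb x)

end PolylineAppend

namespace LatticeSlit

variable {D : DobrushinDomain} {φ : ConformalEquiv upperHalfPlaneSet D.carrier} {δ : ℝ}
  {a w : Site 2}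

/-- **The trace grows along the walk.** [folklore] -/
theorem trace_subset_trace_concat (η : (discreteDomainGraph D.carrier δ).Walk a w) {u : Site 2}
    (h : (discreteDomainGraph D.carrier δ).Adj w u) : trace φ η ⊆ trace φ (η.concat h) :=
  image_mono (inter_subset_inter_left _ (range_toCurve_subset_concat _ η h))

/-- The generating sets grow along the walk. [folklore] -/
theorem pastSet_subset_pastSet_concat (η : (discreteDomainGraph D.carrier δ).Walk a w) {u : Site 2}
    (h : (discreteDomainGraph D.carrier δ).Adj w u) : pastSet φ η ⊆ pastSet φ (η.concat h) :=
  closure_mono (union_subset_union_right _ (trace_subset_trace_concat η h))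

/-- **The hulls grow along the walk**: `K_η ⊆ K_{ηu}` (monotonicity of `Fill_ℍ`, `hpFill_mono`).
[cite: LawlerSchrammWerner2003Restriction, §2 p. 8 (Fillings)] -/
theorem pastHull_subset_pastHull_concat (η : (discreteDomainGraph D.carrier δ).Walk a w) {u : Site 2}
    (h : (discreteDomainGraph D.carrier δ).Adj w u) : pastHull φ η ⊆ pastHull φ (η.concat h) :=
  hpFill_mono (pastSet_subset_pastSet_concat η h)

/-! #### Walks inside the domain: the past hull is a bounded hull -/

/-- The base point of a walk whose polyline stays inside `D` lies in `ℍ`. [folklore] -/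
theorem basePt_mem (η : (discreteDomainGraph D.carrier δ).Walk a w)
    (hη : range (η.toCurve (meshPoint δ)) ⊆ D.carrier) : basePt φ δ a ∈ upperHalfPlaneSet := by
  refine φ.symm_mapsTo (hη ?_)
  exact ⟨0, SimpleGraph.Walk.toCurve_apply_zero _ _⟩

/-- The base point lies on the trace. [folklore] -/
theorem basePt_mem_trace (η : (discreteDomainGraph D.carrier δ).Walk a w)
    (hη : range (η.toCurve (meshPoint δ)) ⊆ D.carrier) : basePt φ δ a ∈ trace φ η := by
  have h0 : meshPoint δ a ∈ range (η.toCurve (meshPoint δ)) := ⟨0, SimpleGraph.Walk.toCurve_apply_zero _ _⟩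
  exact ⟨meshPoint δ a, ⟨h0, hη h0⟩, rfl⟩

/-- For a walk inside `D` the trace is the pull-back of the whole polyline. [folklore] -/
theorem trace_eq_image (η : (discreteDomainGraph D.carrier δ).Walk a w)
    (hη : range (η.toCurve (meshPoint δ)) ⊆ D.carrier) :
    trace φ η = φ.symm '' range (η.toCurve (meshPoint δ)) := by
  rw [trace, inter_eq_left.2 hη]

/-- **The trace of a walk inside `D` is compact and connected** (continuous image of the
polyline under `φ⁻¹`, which is continuous on `D`). [folklore] -/
theorem isCompact_trace_and_isConnected (η : (discreteDomainGraph D.carrier δ).Walk a w)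
    (hη : range (η.toCurve (meshPoint δ)) ⊆ D.carrier) :
    IsCompact (trace φ η) ∧ IsConnected (trace φ η) := by
  rw [trace_eq_image η hη]
  have hc : ContinuousOn φ.symm (range (η.toCurve (meshPoint δ))) := φ.symm.continuousOn.mono hη
  exact ⟨(isCompact_range (η.toCurve (meshPoint δ)).continuous).image_of_continuousOn hc,
    (isConnected_range (η.toCurve (meshPoint δ)).continuous).image _ hc⟩

/-- **The generating set of a walk inside `D` is closed, bounded and attached to `ℝ`**
(`S_η ∪ {Im ≤ 0}` is connected: stem and trace share `z₀`, and the stem accumulates at `0`).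
[folklore] -/
theorem pastSet_attached (η : (discreteDomainGraph D.carrier δ).Walk a w)
    (hη : range (η.toCurve (meshPoint δ)) ⊆ D.carrier) :
    IsClosed (pastSet φ η) ∧ IsBounded (pastSet φ η) ∧
      IsConnected (pastSet φ η ∪ {z : ℂ | z.im ≤ 0}) := by
  have hz₀ : 0 < (basePt φ δ a).im := basePt_mem η hη
  obtain ⟨hKc, hKconn⟩ := isCompact_trace_and_isConnected (φ := φ) η hη
  refine ⟨isClosed_closure, ((isBounded_stemArc hz₀.le).union hKc.isBounded).closure, ?_⟩
  have h1 : IsConnected (stemArc (basePt φ δ a) ∪ trace φ η) :=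
    (isConnected_stemArc hz₀.le).union ⟨_, self_mem_stemArc _, basePt_mem_trace η hη⟩ hKconn
  have h2 : IsConnected (pastSet φ η) := h1.closure
  have h0 : (0 : ℂ) ∈ pastSet φ η :=
    closure_mono subset_union_left (zero_mem_closure_stemArc hz₀)
  refine h2.union ⟨0, h0, show (0 : ℂ).im ≤ 0 by simp⟩ ?_
  exact ⟨⟨0, show (0 : ℂ).im ≤ 0 by simp⟩, (convex_halfSpace_im_le 0).isPreconnected⟩

/-- **The hull of a walk inside `D` is a bounded hull** (`K_η ∈ 𝒬`: the fill of a closed bounded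
set attached to `ℝ`, [LSW] §2 "Fillings", `isBoundedHull_hpFill`).
[cite: LawlerSchrammWerner2003Restriction, §2 p. 8 (Fillings)] -/
theorem isBoundedHull_pastHull (η : (discreteDomainGraph D.carrier δ).Walk a w)
    (hη : range (η.toCurve (meshPoint δ)) ⊆ D.carrier) : IsBoundedHull (pastHull φ η) := by
  obtain ⟨h1, h2, h3⟩ := pastSet_attached (φ := φ) η hη
  exact isBoundedHull_hpFill isSimplyConnected_of_isConnected_compl_holds h1 h2 h3

/-- **So the hull of a walk inside `D` has its hydrodynamic map `g_{K_η}`** (and `capTime`,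
`hcapOf (pastHull φ η)` are genuine half-plane capacities). [cite: Lawler2005, §3.4 Prop. 3.36] -/
theorem hasHydroMap_pastHull (η : (discreteDomainGraph D.carrier δ).Walk a w)
    (hη : range (η.toCurve (meshPoint δ)) ⊆ D.carrier) : HasHydroMap (pastHull φ η) :=
  (isBoundedHull_pastHull η hη).hasHydroMap

/-- The capacity time of a walk inside `D` is nonnegative. [cite: Lawler2005, §3.4 (3.8)] -/
theorem capTime_nonneg (η : (discreteDomainGraph D.carrier δ).Walk a w)
    (hη : range (η.toCurve (meshPoint δ)) ⊆ D.carrier) : 0 ≤ capTime φ η := by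
  have hb : IsBounded (pastHull φ η ∩ upperHalfPlaneSet) :=
    (isBoundedHull_pastHull (φ := φ) η hη).1.subset inter_subset_left
  have := hcapOf_nonneg hb
  rw [capTime]
  linarith

/-- **The capacity time is monotone along the walk** (`t_η ≤ t_{ηu}`, Lawler (2005), (3.8) /
Remark 4.5: "`b` is strictly increasing"), whenever both hulls carry hydrodynamic maps and the
larger one is bounded. [cite: Lawler2005, §4.1 Remark 4.5 with §3.4 (3.8)] -/
theorem capTime_le_capTime_concat (η : (discreteDomainGraph D.carrier δ).Walk a w) {u : Site 2}
    (h : (discreteDomainGraph D.carrier δ).Adj w u) (h₁ : HasHydroMap (pastHull φ η))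
    (h₂ : HasHydroMap (pastHull φ (η.concat h))) (hb : IsBounded (pastHull φ (η.concat h))) :
    capTime φ η ≤ capTime φ (η.concat h) := by
  have hsub := pastHull_subset_pastHull_concat (φ := φ) η h
  have hb₂ : IsBounded (pastHull φ (η.concat h) ∩ upperHalfPlaneSet) := hb.subset inter_subset_left
  have hb₁ : IsBounded (pastHull φ η ∩ upperHalfPlaneSet) :=
    hb.subset (inter_subset_left.trans hsub)
  have hmono := hcapOf_mono h₁ h₂ hb₁ hb₂ (sdiff_subset_sdiff_right hsub)
  rw [capTime, capTime]
  linarith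

/-- So the capacity increments are nonnegative (under the same hypotheses). [folklore] -/
theorem capIncrement_nonneg (η : (discreteDomainGraph D.carrier δ).Walk a w) {u : Site 2}
    (h : (discreteDomainGraph D.carrier δ).Adj w u) (h₁ : HasHydroMap (pastHull φ η))
    (h₂ : HasHydroMap (pastHull φ (η.concat h))) (hb : IsBounded (pastHull φ (η.concat h))) :
    0 ≤ capIncrement φ η u := by
  rw [capIncrement_of_adj η h]
  linarith [capTime_le_capTime_concat η h h₁ h₂ hb]

/-- **`t_η ≤ t_{ηu}` for walks inside `D`** (both hulls are bounded hulls, so the hypotheses of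
`capTime_le_capTime_concat` hold). [cite: Lawler2005, §4.1 Remark 4.5 with §3.4 (3.8)] -/
theorem capTime_le_capTime_concat_of_subset (η : (discreteDomainGraph D.carrier δ).Walk a w)
    {u : Site 2} (h : (discreteDomainGraph D.carrier δ).Adj w u)
    (hη : range ((η.concat h).toCurve (meshPoint δ)) ⊆ D.carrier) :
    capTime φ η ≤ capTime φ (η.concat h) := by
  have hη₀ : range (η.toCurve (meshPoint δ)) ⊆ D.carrier :=
    (range_toCurve_subset_concat _ η h).trans hη
  exact capTime_le_capTime_concat η h (hasHydroMap_pastHull η hη₀) (hasHydroMap_pastHull _ hη)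
    (isBoundedHull_pastHull (φ := φ) _ hη).1

end LatticeSlit

end Literature.Probability.RandomPlanarGeometry
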